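import Summits.Parity.GeneralizedHardyLittlewood.Theorems.PrimeLevelFamEdgeMomentsBeyondDiagonalDiagRemTwoTwoColumns
import Summits.Parity.GeneralizedHardyLittlewood.Theorems.PrimeLevelFamEdgeMomentsBeyondDiagonalDiagRemP2TailBoundPow
import Summits.Parity.GeneralizedHardyLittlewood.Theorems.PrimeLevelFamEdgeMomentsBeyondDiagonalDiagRemDeltaSubPow
import HarnessLib

/-!
# Route `PrimeLevelFamEdge`, crux K_A `MomentsBeyondDiagonal` (stmt-Parity-20007), line «petersson_layers» v4, stub `stub_diag`:
# **the both-sided monomial `a_nP₂ ⊗ a_nP₂ · R` for an ABSTRACT remainder kernel `R`, with the log-saving exponent `A` and the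
# envelope exponent `N` as parameters** (brick of (R₃₃) and of every higher order)

`…DiagRemTwoTwoColumns.abs_bothsided_primeSq_rem00_le₂` (p831205) is the kernel `r₀₀`, `A = 12`, `N = 6`. The order-`(3,3)`
remainder weight has the both-sided monomials `P₂ ⊗ P₂ · r_ab` for `(a,b) ∈ {(0,0),(0,1),(1,0),(0,2),(2,0),(1,1)}` (times `L^p`,
`p ≤ 2`) with envelope exponent `N = 8` and needs the saving `A = 14`; this file proves the bound ONCE for an abstract kernel
`R : ℝ → ℝ` given (i) its two-sequence Abel estimate with constant `C₀` and envelope `9C₀(1+|log 2αY²|)^N`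
(`…DiagRemThreeThreeBose.abs_bose_rem_twoSeq_and_small`, `…DiagRemOneThreeBose.twoSeq_eight₁₃`, …), (ii) the small-argument bound
`|R(y)| ≤ C₀√y` (`0 < y ≤ 1`) and (iii) the large-argument bound `|R(y)| ≤ C₀(1+log y)^M` (`y ≥ 1`, `M ≤ N`), by the
δ-subtraction `…DiagRemDeltaSubPow.abs_doubleSum_delta_sub_le_pow` with `b = a_n·P₂ = c_n·δ₁ + b̃`, the tails of `b̃` from
(P2TAIL)_A (`…DiagRemP2TailBoundPow.abs_sum_copTauW_primeSq_sub_le_pow`), the column bound `(1+log Y)⁴`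
(`…DiagRemInner.abs_sum_copTauW_primeSq_le`) and the corner `c_n²·ℓ⁺(1)ⁱℓ⁺(1)ʲ·|R(α)|` (`≤ C₀√α ≤ C₀√(2αK₁Y)` when `K₁ ≥ 1`,
trivial when `K₁ = 0`):

* `abs_bothsided_primeSq_le_pow` — **`|Σ_{k₁,k₂≤Y}(a_nP₂)(k₁)(a_nP₂)(k₂)ℓ⁺ⁱℓ⁺ʲR(αk₁k₂)| ≤ log^{i+j}Y · C₀ ·
  ((3(L4 + C_P D)L4 + 3C_P D(L4 + C_P D) + (C_P D)²)·√(2αK₁Y) + (18 L4·C_P D + 19(C_P D)²)·x^N/(1+log K₁)^A)`**,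
  `L4 = (1+log Y)⁴`, `D = D(n)`, `x = 1+|log 2αY²|`, `C_P = C_P(A)` from (P2TAIL)_A.

Def-free; theorems only. Helper `--supports stmt-Parity-20007`; closes nothing; K_A, K_B and the Parity summit are NOT proved;
nothing about Landau–Siegel zeros.

## References
* E. Kowalski, P. Michel, J. VanderKam, J. reine angew. Math. 526 (2000), Prop. 5.1 p. 18.
  [cite: KowalskiMichelVanderKam2000, Prop. 5.1 — derivation (both-sided decorated remainder monomials, any order)]
-/

noncomputable section

open Real Finset

namespace Summit.Parity.GeneralizedHardyLittlewood.Theorems.MomentsBeyondDiagonal.DiagCorner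

open Literature.Barriers.Parity (Icc_one_eq_Ioc_zero)
open Summit.Parity.GeneralizedHardyLittlewood.Theorems.BeyondDiagonalBeatsQuarter.KernelFormXSq
  (copTauW copTauW_apply divWeight divWeight_nonneg abs_W_le)
open Summit.Parity.GeneralizedHardyLittlewood.Theorems.BeyondDiagonalBeatsQuarter.Corner

set_option maxHeartbeats 1600000 in
/-- **The both-sided monomial `a_nP₂ ⊗ a_nP₂ · R` for an abstract kernel, saving exponent `A`, envelope exponent `N`** (see the
module docstring). [cite: KowalskiMichelVanderKam2000, Prop. 5.1 — derivation (both-sided decorated remainder monomial)] -/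
theorem abs_bothsided_primeSq_le_pow (A : ℕ) {N M : ℕ} (hMN : M ≤ N) {R : ℝ → ℝ} {C₀ : ℝ} (hC₀ : 0 ≤ C₀)
    (hR2 : ∀ (a₁ a₂ : ℕ → ℝ) (Y α B η : ℝ) (K₁ i j : ℕ), 1 ≤ Y → 0 < α → 1 ≤ i → 1 ≤ j →
      (∀ e : ℕ, e ≤ ⌊Y⌋₊ → |∑ k ∈ Icc 1 e, a₂ k| ≤ B) → (∀ e : ℕ, K₁ ≤ e → |∑ k ∈ Icc 1 e, a₁ k| ≤ η) →
      2 * α * K₁ * Y ≤ 1 →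
    |∑ k₁ ∈ Icc 1 ⌊Y⌋₊, ∑ k₂ ∈ Icc 1 ⌊Y⌋₊,
        a₁ k₁ * a₂ k₂ * ellp Y k₁ ^ i * ellp Y k₂ ^ j * R (α * k₁ * k₂)| ≤
      (∑ k ∈ Icc 1 ⌊Y⌋₊, |a₁ k| * ellp Y k ^ i) * (B * (Real.log Y ^ j * (3 * C₀ * Real.sqrt (2 * α * K₁ * Y)))) +
        (∑ k ∈ Icc 1 ⌊Y⌋₊, |a₂ k| * ellp Y k ^ j) *
          ((2 * η) * (Real.log Y ^ i * (9 * C₀ * (1 + |Real.log (2 * α * Y ^ 2)|) ^ N))))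
    (hRs : ∀ y : ℝ, 0 < y → y ≤ 1 → |R y| ≤ C₀ * Real.sqrt y)
    (hRt : ∀ y : ℝ, 1 ≤ y → |R y| ≤ C₀ * (1 + Real.log y) ^ M) :
    ∃ C_P : ℝ, 0 ≤ C_P ∧
    (∀ n : ℕ, n ≠ 0 → ∀ (Y α : ℝ) (K₁ i j : ℕ), 1 ≤ Y → 0 < α → 1 ≤ i → 1 ≤ j → 2 * α * K₁ * Y ≤ 1 →
    |∑ k₁ ∈ Icc 1 ⌊Y⌋₊, ∑ k₂ ∈ Icc 1 ⌊Y⌋₊,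
        (copTauW n k₁ * ∑ p ∈ k₁.primeFactors, Real.log p ^ 2) *
          (copTauW n k₂ * ∑ p ∈ k₂.primeFactors, Real.log p ^ 2) * ellp Y k₁ ^ i * ellp Y k₂ ^ j *
          R (α * k₁ * k₂)| ≤
      Real.log Y ^ (i + j) * (C₀ *
        ((3 * ((1 + Real.log Y) ^ 4 + C_P * divWeight n) * (1 + Real.log Y) ^ 4 +
            3 * (C_P * divWeight n) * ((1 + Real.log Y) ^ 4 + C_P * divWeight n) + (C_P * divWeight n) ^ 2) *
            Real.sqrt (2 * α * K₁ * Y) +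
          (18 * (1 + Real.log Y) ^ 4 * (C_P * divWeight n) + 19 * (C_P * divWeight n) ^ 2) *
            (1 + |Real.log (2 * α * Y ^ 2)|) ^ N / (1 + Real.log K₁) ^ A))) := by
  obtain ⟨C_P, hC_P, hP⟩ := abs_sum_copTauW_primeSq_sub_le_pow A
  refine ⟨C_P, hC_P, fun n hn Y α K₁ i j hY hα hi hj hY₁ ↦ ?_⟩
  obtain ⟨c, hc, hcy⟩ := hP n hn
  set D : ℝ := divWeight n with hDdef
  have hD0 : 0 ≤ D := divWeight_nonneg n
  have hY0 : 0 < Y := by linarith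
  have hLY : 0 ≤ Real.log Y := Real.log_nonneg hY
  set L4 : ℝ := (1 + Real.log Y) ^ 4 with hL4
  have hL41 : 1 ≤ L4 := one_le_pow₀ (by linarith)
  set W : ℝ := L4 + C_P * D with hW
  have hW0 : 0 ≤ W := by positivity
  set x : ℝ := 1 + |Real.log (2 * α * Y ^ 2)| with hx
  have hx1 : 1 ≤ x := by rw [hx]; linarith [abs_nonneg (Real.log (2 * α * Y ^ 2))]
  set T : ℝ := C_P * D / (1 + Real.log K₁) ^ A with hT
  have hK0 : 0 ≤ Real.log (K₁ : ℝ) := Real.log_natCast_nonneg K₁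
  have hT0 : 0 ≤ T := by positivity
  have hTle : T ≤ C_P * D := div_le_self (by positivity) (one_le_pow₀ (by linarith))
  set sq : ℝ := Real.sqrt (2 * α * K₁ * Y) with hsq
  have hsq0 : 0 ≤ sq := Real.sqrt_nonneg _
  -- the sequence `b = a_n·P₂` and its data
  set b : ℕ → ℝ := fun k ↦ copTauW n k * ∑ p ∈ k.primeFactors, Real.log p ^ 2 with hb
  have hbt : ∀ e : ℕ, K₁ ≤ e → |∑ k ∈ Icc 1 e, (b k - if k = 1 then c else 0)| ≤ T := by
    intro e he
    rcases Nat.eq_zero_or_pos e with rfl | he0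
    · simp only [show Icc (1 : ℕ) 0 = ∅ from Finset.Icc_eq_empty (by norm_num), Finset.sum_empty, abs_zero]
      exact hT0
    · have h1e : 1 ∈ Icc 1 e := Finset.mem_Icc.2 ⟨le_rfl, he0⟩
      have hsum : ∑ k ∈ Icc 1 e, (b k - if k = 1 then c else 0) = (∑ k ∈ Icc 1 e, b k) - c := by
        rw [Finset.sum_sub_distrib, Finset.sum_ite_eq' (Icc 1 e) 1 (fun _ ↦ c), if_pos h1e]
      rw [hsum]
      have h := hcy (e : ℝ) (by exact_mod_cast he0)
      rw [Nat.floor_natCast] at h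
      refine h.trans ?_
      rw [hT]
      apply div_le_div_of_nonneg_left (by positivity) (by positivity)
      have hle : Real.log (K₁ : ℝ) ≤ Real.log (e : ℝ) := by
        rcases Nat.eq_zero_or_pos K₁ with rfl | hK
        · simp only [Nat.cast_zero, Real.log_zero]; exact Real.log_natCast_nonneg e
        · exact Real.log_le_log (by exact_mod_cast hK) (by exact_mod_cast he)
      exact pow_le_pow_left₀ (by positivity) (by linarith) A
  have hbcol : ∀ e : ℕ, e ≤ ⌊Y⌋₊ → |∑ k ∈ Icc 1 e, b k| ≤ L4 := fun e he ↦ abs_sum_copTauW_primeSq_le n hY he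
  -- the abstract δ-subtraction
  have hmain := abs_doubleSum_delta_sub_le_pow N (R := R) hR2 b c T L4 hY hα hi hj hY₁ hbt hbcol
  refine hmain.trans ?_
  -- the absolute sums
  have hSb : ∀ m : ℕ, ∑ k ∈ Icc 1 ⌊Y⌋₊, |b k| * ellp Y k ^ m ≤ Real.log Y ^ m * L4 :=
    fun m ↦ sum_abs_copTauW_primeSq_ellp_pow_le n m hY
  have h1I : 1 ∈ Icc 1 ⌊Y⌋₊ := Finset.mem_Icc.2 ⟨le_rfl, Nat.le_floor (by simpa using hY)⟩
  have hl1 : ellp Y 1 = Real.log Y := by rw [ellp_eq_log hY0.le h1I]; simp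
  have hSbt : ∀ m : ℕ, ∑ k ∈ Icc 1 ⌊Y⌋₊, |b k - if k = 1 then c else 0| * ellp Y k ^ m ≤ Real.log Y ^ m * W := by
    intro m
    have hpt : ∀ k ∈ Icc 1 ⌊Y⌋₊, |b k - if k = 1 then c else 0| * ellp Y k ^ m ≤
        |b k| * ellp Y k ^ m + (if k = 1 then |c| * ellp Y k ^ m else 0) := by
      intro k _
      split_ifs with hk
      · have : |b k - c| ≤ |b k| + |c| := abs_sub _ _
        have h0 : 0 ≤ ellp Y k ^ m := pow_nonneg (ellp_nonneg Y k) m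
        nlinarith
      · rw [sub_zero]; linarith
    refine (Finset.sum_le_sum hpt).trans ?_
    rw [Finset.sum_add_distrib, Finset.sum_ite_eq' (Icc 1 ⌊Y⌋₊) 1, if_pos h1I, hl1]
    have := hSb m
    rw [hW]; nlinarith [pow_nonneg hLY m]
  have hSδ : ∑ k ∈ Icc 1 ⌊Y⌋₊, |(if k = 1 then (1 : ℝ) else 0)| * ellp Y k ^ i = Real.log Y ^ i := by
    rw [Finset.sum_eq_single_of_mem 1 h1I (fun k _ hk ↦ by simp [hk])]
    simp [hl1]
  -- the `δ⊗δ` value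
  have hRα : |R α| ≤ C₀ * (sq + x ^ N / (1 + Real.log K₁) ^ A) := by
    rcases Nat.eq_zero_or_pos K₁ with hK | hK
    · -- threshold `0`: no constraint on `α`; trivial bound by `C₀·x⁶`
      have hK' : (K₁ : ℝ) = 0 := by exact_mod_cast hK
      have hden : (1 + Real.log (K₁ : ℝ)) ^ A = 1 := by rw [hK', Real.log_zero, add_zero, one_pow]
      rw [hden, div_one]
      have hx6 : x ^ M ≤ x ^ N := pow_le_pow_right₀ hx1 hMN
      have hx60 : 1 ≤ x ^ N := one_le_pow₀ hx1
      rcases le_or_gt α 1 with hα1 | hα1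
      · have h := hRs α hα hα1
        have : Real.sqrt α ≤ 1 := Real.sqrt_le_one.mpr hα1 |>.trans_eq' rfl
        calc _ ≤ C₀ * Real.sqrt α := h
          _ ≤ C₀ * 1 := mul_le_mul_of_nonneg_left (Real.sqrt_le_one.2 hα1) hC₀
          _ ≤ C₀ * (sq + x ^ N) := by
              apply mul_le_mul_of_nonneg_left _ hC₀; nlinarith
      · have h := hRt α hα1.le
        have hlx : 1 + Real.log α ≤ x := by
          rw [hx]
          have hlog : Real.log (2 * α * Y ^ 2) = Real.log 2 + Real.log α + 2 * Real.log Y := by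
            rw [Real.log_mul (by positivity) (by positivity), Real.log_mul (by norm_num) hα.ne', Real.log_pow]
            push_cast; ring
          have hl2 : 0 < Real.log 2 := Real.log_pos (by norm_num)
          have : Real.log α ≤ |Real.log (2 * α * Y ^ 2)| := by
            rw [hlog]; exact le_trans (by linarith) (le_abs_self _)
          linarith
        have hla1 : 0 ≤ 1 + Real.log α := by linarith [Real.log_nonneg hα1.le]
        have hpowM : (1 + Real.log α) ^ M ≤ x ^ M := pow_le_pow_left₀ hla1 hlx M
        calc _ ≤ C₀ * (1 + Real.log α) ^ M := h
          _ ≤ C₀ * x ^ N := mul_le_mul_of_nonneg_left (hpowM.trans hx6) hC₀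
          _ ≤ C₀ * (sq + x ^ N) := by apply mul_le_mul_of_nonneg_left _ hC₀; linarith
    · -- threshold `K₁ ≥ 1`: `α ≤ 2αK₁Y ≤ 1`, power saving
      have hK1 : (1 : ℝ) ≤ K₁ := by exact_mod_cast hK
      have hαle : α ≤ 2 * α * K₁ * Y := by
        have h2 : (1 : ℝ) ≤ 2 * K₁ * Y := by nlinarith
        have := mul_le_mul_of_nonneg_left h2 hα.le
        linarith
      have hα1 : α ≤ 1 := hαle.trans hY₁
      have h := hRs α hα hα1
      calc _ ≤ C₀ * Real.sqrt α := h
        _ ≤ C₀ * sq := mul_le_mul_of_nonneg_left (Real.sqrt_le_sqrt hαle) hC₀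
        _ ≤ C₀ * (sq + x ^ N / (1 + Real.log K₁) ^ A) := by
            apply mul_le_mul_of_nonneg_left _ hC₀
            have : 0 ≤ x ^ N / (1 + Real.log K₁) ^ A := by positivity
            linarith
  -- bookkeeping
  have hLi : 0 ≤ Real.log Y ^ i := pow_nonneg hLY i
  have hLj : 0 ≤ Real.log Y ^ j := pow_nonneg hLY j
  set CD : ℝ := C_P * D with hCD
  have hCD0 : 0 ≤ CD := by positivity
  have hc' : |c| ≤ CD := hc
  have hx6 : 0 ≤ x ^ N := by positivity
  have hK12 : 0 < (1 + Real.log (K₁ : ℝ)) ^ A := by positivity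
  have hP3 : 0 ≤ 3 * C₀ * sq := by positivity
  have hP9 : 0 ≤ 9 * C₀ * x ^ N := by positivity
  have hTdef : T = CD / (1 + Real.log K₁) ^ A := by rw [hT, hCD]
  have t1 : (∑ k ∈ Icc 1 ⌊Y⌋₊, |b k - if k = 1 then c else 0| * ellp Y k ^ i) *
      (L4 * (Real.log Y ^ j * (3 * C₀ * sq))) ≤ Real.log Y ^ (i + j) * (C₀ * (3 * W * L4 * sq)) := by
    have hX : 0 ≤ L4 * (Real.log Y ^ j * (3 * C₀ * sq)) := by positivity
    calc _ ≤ (Real.log Y ^ i * W) * (L4 * (Real.log Y ^ j * (3 * C₀ * sq))) :=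
          mul_le_mul_of_nonneg_right (hSbt i) hX
      _ = _ := by rw [pow_add]; ring
  have t2 : (∑ k ∈ Icc 1 ⌊Y⌋₊, |b k| * ellp Y k ^ j) * ((2 * T) * (Real.log Y ^ i * (9 * C₀ * x ^ N))) ≤
      Real.log Y ^ (i + j) * (C₀ * (18 * L4 * CD * x ^ N / (1 + Real.log K₁) ^ A)) := by
    have hX : 0 ≤ (2 * T) * (Real.log Y ^ i * (9 * C₀ * x ^ N)) := by positivity
    calc _ ≤ (Real.log Y ^ j * L4) * ((2 * T) * (Real.log Y ^ i * (9 * C₀ * x ^ N))) :=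
          mul_le_mul_of_nonneg_right (hSb j) hX
      _ = _ := by rw [pow_add, hTdef]; field_simp; ring
  have t3 : |c| * ((∑ k ∈ Icc 1 ⌊Y⌋₊, |b k - if k = 1 then c else 0| * ellp Y k ^ j) *
      (1 * (Real.log Y ^ i * (3 * C₀ * sq)))) ≤ Real.log Y ^ (i + j) * (C₀ * (3 * CD * W * sq)) := by
    have hX : 0 ≤ 1 * (Real.log Y ^ i * (3 * C₀ * sq)) := by rw [one_mul]; exact mul_nonneg hLi hP3
    calc _ ≤ |c| * ((Real.log Y ^ j * W) * (1 * (Real.log Y ^ i * (3 * C₀ * sq)))) :=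
          mul_le_mul_of_nonneg_left (mul_le_mul_of_nonneg_right (hSbt j) hX) (abs_nonneg c)
      _ ≤ CD * ((Real.log Y ^ j * W) * (1 * (Real.log Y ^ i * (3 * C₀ * sq)))) :=
          mul_le_mul_of_nonneg_right hc' (mul_nonneg (mul_nonneg hLj hW0) hX)
      _ = _ := by rw [pow_add]; ring
  have t4 : |c| * ((∑ k ∈ Icc 1 ⌊Y⌋₊, |(if k = 1 then (1 : ℝ) else 0)| * ellp Y k ^ i) *
      ((2 * T) * (Real.log Y ^ j * (9 * C₀ * x ^ N)))) ≤
      Real.log Y ^ (i + j) * (C₀ * (18 * CD ^ 2 * x ^ N / (1 + Real.log K₁) ^ A)) := by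
    rw [hSδ]
    have hX : 0 ≤ Real.log Y ^ i * ((2 * T) * (Real.log Y ^ j * (9 * C₀ * x ^ N))) := by positivity
    calc _ ≤ CD * (Real.log Y ^ i * ((2 * T) * (Real.log Y ^ j * (9 * C₀ * x ^ N)))) :=
          mul_le_mul_of_nonneg_right hc' hX
      _ = _ := by rw [pow_add, hTdef]; field_simp; ring
  have t5 : c ^ 2 * Real.log Y ^ i * Real.log Y ^ j * |R α| ≤
      Real.log Y ^ (i + j) * (C₀ * (CD ^ 2 * (sq + x ^ N / (1 + Real.log K₁) ^ A))) := by
    have hc2 : c ^ 2 ≤ CD ^ 2 := by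
      rw [← sq_abs]; exact pow_le_pow_left₀ (abs_nonneg c) hc' 2
    have hCD2 : 0 ≤ CD ^ 2 := pow_nonneg hCD0 2
    calc _ ≤ CD ^ 2 * Real.log Y ^ i * Real.log Y ^ j * (C₀ * (sq + x ^ N / (1 + Real.log K₁) ^ A)) :=
          mul_le_mul (mul_le_mul_of_nonneg_right (mul_le_mul_of_nonneg_right hc2 hLi) hLj) hRα (abs_nonneg _)
            (mul_nonneg (mul_nonneg hCD2 hLi) hLj)
      _ = _ := by rw [pow_add]; ring
  rw [hl1]
  have hsum := add_le_add (add_le_add (add_le_add t1 t2) (add_le_add t3 t4)) t5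
  refine le_trans (le_of_eq ?_) (hsum.trans (le_of_eq ?_))
  · ring
  · rw [hCD]; field_simp; ring

end Summit.Parity.GeneralizedHardyLittlewood.Theorems.MomentsBeyondDiagonal.DiagCorner

end
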